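import Mathlib

/-!
# T⁴ programme, spine node NE2 (U1a), tier B support row B4.d — THE ONE-STEP EFFECTIVE OPERATOR and the EXACT SANDWICH
# IDENTITY `Jᴴ (A + J B Jᴴ)⁻¹ J = (Ã + B)⁻¹` (abstract linear algebra; file 1 of row B4.d)

NE2 formalisation swarm `b2b-balaban-t4-ne2-formalise-*`, seat LEAF PROVER 04, support row B4.d of `t4/formal/NE2/LEAVES.md`
(«U = 1 scalar free-tower laws against King's pairing» — the datum «free scalar-tower planting/complement defects» of row B4.b's
abstract law).  The analytic heart of those laws is a ONE-STEP SANDWICH LAW `‖Jᴴ G′_{k+1} J − G′_k‖ = O(L^{−2k})` for the massive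
scalar propagators `G′_k = (Δ_k + a′Q′_k*Q′_k)⁻¹` and King's isometric planting `J = J_k` (`Jᴴ J = 1`).  This file isolates the
EXACT ALGEBRA behind it, with no lattice in sight.

For an isometry `J : m ← n` (`JᴴJ = 1`) and an operator `A` on `m` (think: the finer Laplacian), put `K₁ := A + JJᴴ`,
`S := Jᴴ K₁⁻¹ J` and define

 * the **effective operator** `Ã := effOp A J := S⁻¹ − 1` on `n` (for `A` = a fine Laplacian and `J` = block planting this is
   the ONE-STEP EFFECTIVE LAPLACIAN: the Schur complement of `A` along the block-constant fields = the energy of the block-constrained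
   minimiser — the structure behind King's composed symbols [King1986] (4.5) p.670, (4.12) p.671, here as an operator identity);
 * the **extension** `E := extOp A J := K₁⁻¹ J (Ã + 1)` (`m ← n`; the minimiser map).

THEOREMS (all [folklore] linear algebra; hypotheses bundled in `Admissible A J`: `JᴴJ = 1`, `K₁` and `S` invertible — both follow
from `(A + JJᴴ).PosDef`, `admissible_of_posDef`):
 * `conjTranspose_mul_extOp : Jᴴ E = 1`, `mul_extOp : A E = J Ã` — the two identities that CHARACTERISE `(E, Ã)` (`effOp_unique`);
 * **`sandwich_inv_eq`**: for EVERY `B` on `n` with `A + J B Jᴴ` invertible, `Jᴴ (A + J B Jᴴ)⁻¹ J = (Ã + B)⁻¹` (and `Ã + B` is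
   invertible, `isUnit_effOp_add`).  Mechanism: `(A + JBJᴴ)E = J(Ã + B)`, so `1 = JᴴE = [Jᴴ(A + JBJᴴ)⁻¹J](Ã + B)`.
   In the tower the mass term of the scalar layer IS of the form `JBJᴴ` (`Q′_{k+1}*Q′_{k+1} = J_k (Q′_k*Q′_k) J_kᴴ` exactly), so the
   planted-and-averaged finer propagator is EXACTLY the coarser propagator of the effective Laplacian: the comparison with `G′_k`
   is then a resolvent identity plus a symbol estimate for `Δ_k − Δ̃_k` (files 3–4 of the row);
 * `effOp_isHermitian`, the ENERGY IDENTITY `Eᴴ A E = Ã`, `effOp_posSemidef`, and the two variational comparisons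
   `le_effOp_of_conj_le` (`JCJᴴ ≤ A ⇒ C ≤ Ã`) and `effOp_le_sandwich` (`Ã ≤ JᴴAJ`, since `JᴴAJ − Ã = (E − J)ᴴA(E − J)`).

HONEST FRAMING (T4-DAG p. 1).  Pure finite-dimensional matrix algebra over `ℂ`; nothing printed is used as a hypothesis; a SUPPORT
input of row B4.b at U = 1, NOT B4, NOT [Balaban1985BackgroundPropagators] (3.23)–(3.26) as printed; NE2 NOT proved; NOT infinite
volume / mass gap / Clay / summit progress; spine 0/9 unchanged.  HONEST DEPENDENCY: continuum YM on T⁴ ⇐ BetaPertH ∧ nine spine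
estimates (0/9 proved); BetaPertH ⇐ (D1) ∧ (D4) ∧ CAP+tail; G-an2-4 gates asym, D1 and NE2/3/4.  ABSOLUTE RULE kept; no `sorry`.
-/

noncomputable section

open scoped Matrix ComplexOrder

namespace Summit.QuantumFields.BalabanUV.T4Continuum.OneStepEffectiveOperator

variable {m n : Type*} [Fintype m] [Fintype n] [DecidableEq m] [DecidableEq n]

/-! ## §1 The objects -/

/-- the regularised operator `K₁ = A + JJᴴ`. [folklore] -/
def regOp (A : Matrix m m ℂ) (J : Matrix m n ℂ) : Matrix m m ℂ := A + J * Jᴴ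

/-- the regularised sandwich `S = Jᴴ (A + JJᴴ)⁻¹ J`. [folklore] -/
def sandwichReg (A : Matrix m m ℂ) (J : Matrix m n ℂ) : Matrix n n ℂ := Jᴴ * (regOp A J)⁻¹ * J

/-- **THE ONE-STEP EFFECTIVE OPERATOR** `Ã = (Jᴴ(A + JJᴴ)⁻¹J)⁻¹ − 1` (Schur complement of `A` along the range of `J`; for a fine
Laplacian and the block planting: the effective Laplacian one level down). [cite: King1986, (4.5) p.670, (4.12) p.671 (shape: the
composed symbol of the effective Laplacian)] [folklore] -/
def effOp (A : Matrix m m ℂ) (J : Matrix m n ℂ) : Matrix n n ℂ := (sandwichReg A J)⁻¹ - 1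

/-- **THE EXTENSION (minimiser) MAP** `E = (A + JJᴴ)⁻¹ J (Ã + 1)`. [folklore] -/
def extOp (A : Matrix m m ℂ) (J : Matrix m n ℂ) : Matrix m n ℂ := (regOp A J)⁻¹ * J * (effOp A J + 1)

/-- the standing hypotheses: `J` is an isometry and the two regularised objects are invertible. [folklore] -/
structure Admissible (A : Matrix m m ℂ) (J : Matrix m n ℂ) : Prop where
  /-- `JᴴJ = 1` -/
  isometry : Jᴴ * J = 1
  /-- `A + JJᴴ` is invertible -/
  isUnit_reg : IsUnit (regOp A J)
  /-- `Jᴴ(A + JJᴴ)⁻¹J` is invertible -/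
  isUnit_sandwich : IsUnit (sandwichReg A J)

variable {A : Matrix m m ℂ} {J : Matrix m n ℂ}

/-- `Ã + 1 = S⁻¹`. [folklore] -/
theorem effOp_add_one : effOp A J + 1 = (sandwichReg A J)⁻¹ := sub_add_cancel _ _

omit [DecidableEq m] in
/-- an isometry is injective on vectors. [folklore] -/
theorem mulVec_injective_of_isometry (hJ : Jᴴ * J = 1) : Function.Injective J.mulVec := by
  intro x y hxy
  have h := congrArg (fun v => Jᴴ *ᵥ v) hxy
  simpa only [Matrix.mulVec_mulVec, hJ, Matrix.one_mulVec] using h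

/-- **admissibility from positivity**: `JᴴJ = 1` and `A + JJᴴ` positive definite. [folklore] -/
theorem admissible_of_posDef (hJ : Jᴴ * J = 1) (hK : (A + J * Jᴴ).PosDef) : Admissible A J := by
  have hreg : (regOp A J).PosDef := hK
  refine ⟨hJ, hreg.isUnit, ?_⟩
  have hS : (sandwichReg A J).PosDef := by
    unfold sandwichReg
    exact hreg.inv.conjTranspose_mul_mul_same (mulVec_injective_of_isometry hJ)
  exact hS.isUnit

omit [DecidableEq m] in
/-- a sufficient condition for `A + JBJᴴ` to be positive definite: `A, B` positive semidefinite and `A + c·JJᴴ ≤ A + JBJᴴ`-type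
domination is NOT needed — we only record the simplest usable form: `A + JBJᴴ ≥ A + β·JJᴴ` with `β > 0` and `A + JJᴴ > 0`. [folklore] -/
theorem posDef_add_conj_of_le (hA : A.PosSemidef) (hK : (A + J * Jᴴ).PosDef) {B : Matrix n n ℂ} {β : ℝ} (hβ : 0 < β)
    (hB : (B - (β : ℂ) • (1 : Matrix n n ℂ)).PosSemidef) : (A + J * B * Jᴴ).PosDef := by
  refine Matrix.PosDef.of_dotProduct_mulVec_pos ?_ fun x hx => ?_
  · have hBh : B.IsHermitian := by
      have h1 := hB.isHermitian
      have e : B = (B - (β : ℂ) • (1 : Matrix n n ℂ)) + (β : ℂ) • (1 : Matrix n n ℂ) := (sub_add_cancel _ _).symm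
      rw [e]
      refine h1.add ?_
      unfold Matrix.IsHermitian
      rw [Matrix.conjTranspose_smul, Matrix.conjTranspose_one, Complex.star_def, Complex.conj_ofReal]
    exact hA.isHermitian.add (by simpa only [Matrix.mul_assoc] using Matrix.isHermitian_mul_mul_conjTranspose J hBh)
  · -- `xᴴ(A + JBJᴴ)x = xᴴAx + yᴴBy ≥ xᴴAx + β‖y‖² ≥ min(1,β)·xᴴ(A + JJᴴ)x > 0`, `y = Jᴴx`
    have hKx := hK.dotProduct_mulVec_pos hx
    have hAx := hA.dotProduct_mulVec_nonneg x
    have hBy := hB.dotProduct_mulVec_nonneg (Jᴴ *ᵥ x)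
    have key : ∀ w, star x ⬝ᵥ (J *ᵥ w) = star (Jᴴ *ᵥ x) ⬝ᵥ w := fun w => by
      rw [Matrix.dotProduct_mulVec, Matrix.star_mulVec, Matrix.conjTranspose_conjTranspose]
    have e1 : star x ⬝ᵥ ((A + J * B * Jᴴ) *ᵥ x) = star x ⬝ᵥ (A *ᵥ x) + star (Jᴴ *ᵥ x) ⬝ᵥ (B *ᵥ (Jᴴ *ᵥ x)) := by
      rw [Matrix.add_mulVec, dotProduct_add, ← Matrix.mulVec_mulVec, ← Matrix.mulVec_mulVec, key]
    have e2 : star x ⬝ᵥ ((A + J * Jᴴ) *ᵥ x) = star x ⬝ᵥ (A *ᵥ x) + star (Jᴴ *ᵥ x) ⬝ᵥ (Jᴴ *ᵥ x) := by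
      rw [Matrix.add_mulVec, dotProduct_add, ← Matrix.mulVec_mulVec, key]
    have e3 : star (Jᴴ *ᵥ x) ⬝ᵥ ((B - (β : ℂ) • (1 : Matrix n n ℂ)) *ᵥ (Jᴴ *ᵥ x))
        = star (Jᴴ *ᵥ x) ⬝ᵥ (B *ᵥ (Jᴴ *ᵥ x)) - (β : ℂ) * (star (Jᴴ *ᵥ x) ⬝ᵥ (Jᴴ *ᵥ x)) := by
      rw [Matrix.sub_mulVec, dotProduct_sub, Matrix.smul_mulVec, Matrix.one_mulVec, dotProduct_smul, smul_eq_mul]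
    rw [e3] at hBy
    rw [e2] at hKx
    rw [e1]
    -- real parts
    have hy0 : 0 ≤ star (Jᴴ *ᵥ x) ⬝ᵥ (Jᴴ *ᵥ x) := dotProduct_star_self_nonneg _
    by_cases hcase : (1 : ℝ) ≤ β
    · -- then `yᴴBy ≥ β‖y‖² ≥ ‖y‖²`
      have h1 : star (Jᴴ *ᵥ x) ⬝ᵥ (Jᴴ *ᵥ x) ≤ (β : ℂ) * (star (Jᴴ *ᵥ x) ⬝ᵥ (Jᴴ *ᵥ x)) := by
        have : ((1 : ℝ) : ℂ) * (star (Jᴴ *ᵥ x) ⬝ᵥ (Jᴴ *ᵥ x)) ≤ (β : ℂ) * (star (Jᴴ *ᵥ x) ⬝ᵥ (Jᴴ *ᵥ x)) :=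
          mul_le_mul_of_nonneg_right (Complex.real_le_real.mpr hcase) hy0
        simpa using this
      calc (0 : ℂ) < star x ⬝ᵥ (A *ᵥ x) + star (Jᴴ *ᵥ x) ⬝ᵥ (Jᴴ *ᵥ x) := hKx
        _ ≤ star x ⬝ᵥ (A *ᵥ x) + (β : ℂ) * (star (Jᴴ *ᵥ x) ⬝ᵥ (Jᴴ *ᵥ x)) := add_le_add le_rfl h1
        _ ≤ star x ⬝ᵥ (A *ᵥ x) + star (Jᴴ *ᵥ x) ⬝ᵥ (B *ᵥ (Jᴴ *ᵥ x)) := add_le_add le_rfl (sub_nonneg.mp hBy)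
    · -- `β < 1`: `xᴴAx + yᴴBy ≥ xᴴAx + β‖y‖² ≥ β(xᴴAx + ‖y‖²) > 0`
      have hβ1 : β ≤ 1 := le_of_lt (not_le.mp hcase)
      have h2 : (β : ℂ) * (star x ⬝ᵥ (A *ᵥ x)) ≤ star x ⬝ᵥ (A *ᵥ x) := by
        have : (β : ℂ) * (star x ⬝ᵥ (A *ᵥ x)) ≤ ((1 : ℝ) : ℂ) * (star x ⬝ᵥ (A *ᵥ x)) :=
          mul_le_mul_of_nonneg_right (Complex.real_le_real.mpr hβ1) hAx
        simpa using this
      have hβC : (0 : ℂ) < (β : ℂ) := by exact_mod_cast hβ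
      calc (0 : ℂ) < (β : ℂ) * (star x ⬝ᵥ (A *ᵥ x) + star (Jᴴ *ᵥ x) ⬝ᵥ (Jᴴ *ᵥ x)) := mul_pos hβC hKx
        _ = (β : ℂ) * (star x ⬝ᵥ (A *ᵥ x)) + (β : ℂ) * (star (Jᴴ *ᵥ x) ⬝ᵥ (Jᴴ *ᵥ x)) := mul_add _ _ _
        _ ≤ star x ⬝ᵥ (A *ᵥ x) + (β : ℂ) * (star (Jᴴ *ᵥ x) ⬝ᵥ (Jᴴ *ᵥ x)) := add_le_add h2 le_rfl
        _ ≤ star x ⬝ᵥ (A *ᵥ x) + star (Jᴴ *ᵥ x) ⬝ᵥ (B *ᵥ (Jᴴ *ᵥ x)) := add_le_add le_rfl (sub_nonneg.mp hBy)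

/-! ## §2 The two identities characterising `(E, Ã)` -/

/-- **`Jᴴ E = 1`**. [folklore] -/
theorem conjTranspose_mul_extOp (h : Admissible A J) : Jᴴ * extOp A J = 1 := by
  have hS := (Matrix.isUnit_iff_isUnit_det _).mp h.isUnit_sandwich
  unfold extOp
  rw [effOp_add_one]
  calc Jᴴ * ((regOp A J)⁻¹ * J * (sandwichReg A J)⁻¹) = sandwichReg A J * (sandwichReg A J)⁻¹ := by
        simp only [sandwichReg, Matrix.mul_assoc]
    _ = 1 := Matrix.mul_nonsing_inv _ hS

/-- **`A E = J Ã`**: `A` maps the extension into the range of `J` (the minimiser's Euler–Lagrange equation). [folklore] -/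
theorem mul_extOp (h : Admissible A J) : A * extOp A J = J * effOp A J := by
  have hK := (Matrix.isUnit_iff_isUnit_det _).mp h.isUnit_reg
  have hS := (Matrix.isUnit_iff_isUnit_det _).mp h.isUnit_sandwich
  have eA : A = regOp A J - J * Jᴴ := (add_sub_cancel_right _ _).symm
  have e1 : regOp A J * extOp A J = J * (sandwichReg A J)⁻¹ := by
    unfold extOp
    rw [effOp_add_one, ← Matrix.mul_assoc, ← Matrix.mul_assoc, Matrix.mul_nonsing_inv _ hK, Matrix.one_mul]
  have e2 : J * Jᴴ * extOp A J = J := by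
    rw [Matrix.mul_assoc, conjTranspose_mul_extOp h, Matrix.mul_one]
  have e3 : A * extOp A J = regOp A J * extOp A J - J * Jᴴ * extOp A J := by
    rw [← Matrix.sub_mul, ← eA]
  rw [e3, e1, e2, effOp, Matrix.mul_sub, Matrix.mul_one]

/-- **UNIQUENESS**: any pair `(E′, Ã′)` with `JᴴE′ = 1` and `AE′ = JÃ′` is `(E, Ã)`. [folklore] -/
theorem effOp_unique (h : Admissible A J) {E' : Matrix m n ℂ} {At' : Matrix n n ℂ} (h1 : Jᴴ * E' = 1) (h2 : A * E' = J * At') :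
    At' = effOp A J ∧ E' = extOp A J := by
  have hK := (Matrix.isUnit_iff_isUnit_det _).mp h.isUnit_reg
  have hS := (Matrix.isUnit_iff_isUnit_det _).mp h.isUnit_sandwich
  -- `K₁ E′ = J (Ã′ + 1)` hence `E′ = K₁⁻¹ J (Ã′ + 1)` and `1 = JᴴE′ = S (Ã′ + 1)`
  have e1 : regOp A J * E' = J * (At' + 1) := by
    rw [regOp, Matrix.add_mul, h2, Matrix.mul_assoc, h1, Matrix.mul_add, Matrix.mul_one]
  have e2 : E' = (regOp A J)⁻¹ * J * (At' + 1) := by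
    rw [Matrix.mul_assoc, ← e1, ← Matrix.mul_assoc, Matrix.nonsing_inv_mul _ hK, Matrix.one_mul]
  have e3 : sandwichReg A J * (At' + 1) = 1 := by
    rw [sandwichReg, Matrix.mul_assoc, Matrix.mul_assoc, ← Matrix.mul_assoc ((regOp A J)⁻¹), ← e2, h1]
  have e4 : At' + 1 = (sandwichReg A J)⁻¹ := by
    rw [← Matrix.inv_eq_right_inv e3]
  have hAt : At' = effOp A J := by
    rw [effOp, ← e4, add_sub_cancel_right]
  refine ⟨hAt, ?_⟩
  rw [e2, extOp, hAt]

/-! ## §3 THE SANDWICH IDENTITY -/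

/-- `(A + JBJᴴ) E = J (Ã + B)`. [folklore] -/
theorem add_conj_mul_extOp (h : Admissible A J) (B : Matrix n n ℂ) :
    (A + J * B * Jᴴ) * extOp A J = J * (effOp A J + B) := by
  rw [Matrix.add_mul, mul_extOp h, Matrix.mul_assoc (J * B), conjTranspose_mul_extOp h, Matrix.mul_one, Matrix.mul_add]

/-- `[Jᴴ(A + JBJᴴ)⁻¹J]·(Ã + B) = 1`. [folklore] -/
theorem sandwich_mul_effOp_add (h : Admissible A J) {B : Matrix n n ℂ} (hB : IsUnit (A + J * B * Jᴴ)) :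
    Jᴴ * (A + J * B * Jᴴ)⁻¹ * J * (effOp A J + B) = 1 := by
  have hB' := (Matrix.isUnit_iff_isUnit_det _).mp hB
  have e : (A + J * B * Jᴴ)⁻¹ * (J * (effOp A J + B)) = extOp A J := by
    rw [← add_conj_mul_extOp h B, ← Matrix.mul_assoc, Matrix.nonsing_inv_mul _ hB', Matrix.one_mul]
  calc Jᴴ * (A + J * B * Jᴴ)⁻¹ * J * (effOp A J + B) = Jᴴ * ((A + J * B * Jᴴ)⁻¹ * (J * (effOp A J + B))) := by
        simp only [Matrix.mul_assoc]
    _ = 1 := by rw [e, conjTranspose_mul_extOp h]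

/-- `Ã + B` is invertible whenever `A + JBJᴴ` is. [folklore] -/
theorem isUnit_effOp_add (h : Admissible A J) {B : Matrix n n ℂ} (hB : IsUnit (A + J * B * Jᴴ)) : IsUnit (effOp A J + B) :=
  IsUnit.of_mul_eq_one_right _ (sandwich_mul_effOp_add h hB)

/-- **THE SANDWICH IDENTITY**: `Jᴴ (A + J B Jᴴ)⁻¹ J = (Ã + B)⁻¹` for every `B` with `A + JBJᴴ` invertible — averaging-and-planting the
finer massive propagator gives EXACTLY the coarser propagator of the effective operator. [cite: King1986, (4.5) p.670, (4.12) p.671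
(the composition structure of the effective Laplacian, scalar, A = 0)] [folklore] -/
theorem sandwich_inv_eq (h : Admissible A J) {B : Matrix n n ℂ} (hB : IsUnit (A + J * B * Jᴴ)) :
    Jᴴ * (A + J * B * Jᴴ)⁻¹ * J = (effOp A J + B)⁻¹ :=
  (Matrix.inv_eq_left_inv (sandwich_mul_effOp_add h hB)).symm

/-- the same with the mass term written as `JBJᴴ = B′` for any `B′` that IS of that form. [folklore] -/
theorem sandwich_inv_eq' (h : Admissible A J) {B : Matrix n n ℂ} {B' : Matrix m m ℂ} (hB' : B' = J * B * Jᴴ)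
    (hB : IsUnit (A + B')) : Jᴴ * (A + B')⁻¹ * J = (effOp A J + B)⁻¹ := by
  subst hB'; exact sandwich_inv_eq h hB

/-! ## §4 Symmetry, energy, comparisons -/

omit [Fintype m] [DecidableEq m] [DecidableEq n] in
/-- `K₁` is Hermitian when `A` is. [folklore] -/
theorem regOp_isHermitian (hA : A.IsHermitian) : (regOp A J).IsHermitian :=
  hA.add (Matrix.isHermitian_mul_conjTranspose_self J)

omit [DecidableEq n] in
/-- `S` is Hermitian when `A` is. [folklore] -/
theorem sandwichReg_isHermitian (hA : A.IsHermitian) : (sandwichReg A J).IsHermitian := by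
  unfold sandwichReg
  exact Matrix.isHermitian_conjTranspose_mul_mul J (regOp_isHermitian hA).inv

/-- **`Ã` is Hermitian** when `A` is. [folklore] -/
theorem effOp_isHermitian (hA : A.IsHermitian) : (effOp A J).IsHermitian :=
  (sandwichReg_isHermitian hA).inv.sub Matrix.isHermitian_one

/-- **THE ENERGY IDENTITY** `Eᴴ A E = Ã`. [folklore] -/
theorem conjTranspose_extOp_mul_mul_extOp (h : Admissible A J) : (extOp A J)ᴴ * A * extOp A J = effOp A J := by
  rw [Matrix.mul_assoc, mul_extOp h, ← Matrix.mul_assoc, ← Matrix.conjTranspose_conjTranspose J,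
    ← Matrix.conjTranspose_mul, Matrix.conjTranspose_conjTranspose, conjTranspose_mul_extOp h, Matrix.conjTranspose_one,
    Matrix.one_mul]

/-- **`Ã` is positive semidefinite** when `A` is. [folklore] -/
theorem effOp_posSemidef (h : Admissible A J) (hA : A.PosSemidef) : (effOp A J).PosSemidef := by
  rw [← conjTranspose_extOp_mul_mul_extOp h]
  exact hA.conjTranspose_mul_mul_same _

/-- **LOWER COMPARISON**: if `JCJᴴ ≤ A` (i.e. `A − JCJᴴ ≥ 0`) then `C ≤ Ã` (`Ã − C = Eᴴ(A − JCJᴴ)E ≥ 0`). [folklore] -/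
theorem le_effOp_of_conj_le (h : Admissible A J) {C : Matrix n n ℂ} (hC : (A - J * C * Jᴴ).PosSemidef) :
    (effOp A J - C).PosSemidef := by
  have hJE : Jᴴ * extOp A J = 1 := conjTranspose_mul_extOp h
  have hEJ : (extOp A J)ᴴ * J = 1 := by
    have h1 := congrArg Matrix.conjTranspose hJE
    rwa [Matrix.conjTranspose_mul, Matrix.conjTranspose_conjTranspose, Matrix.conjTranspose_one] at h1
  have e2 : (extOp A J)ᴴ * (J * C * Jᴴ) * extOp A J = C := by
    calc (extOp A J)ᴴ * (J * C * Jᴴ) * extOp A J = ((extOp A J)ᴴ * J) * C * (Jᴴ * extOp A J) := by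
          simp only [Matrix.mul_assoc]
      _ = C := by rw [hEJ, hJE, Matrix.one_mul, Matrix.mul_one]
  have e : effOp A J - C = (extOp A J)ᴴ * (A - J * C * Jᴴ) * extOp A J := by
    rw [Matrix.mul_sub, Matrix.sub_mul, conjTranspose_extOp_mul_mul_extOp h, e2]
  rw [e]
  exact hC.conjTranspose_mul_mul_same _

/-- `Jᴴ A E = Ã`. [folklore] -/
theorem conjTranspose_mul_mul_extOp (h : Admissible A J) : Jᴴ * A * extOp A J = effOp A J := by
  rw [Matrix.mul_assoc, mul_extOp h, ← Matrix.mul_assoc, h.isometry, Matrix.one_mul]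

/-- `Eᴴ A J = Ã` (for Hermitian `A`). [folklore] -/
theorem conjTranspose_extOp_mul_mul (h : Admissible A J) (hA : A.IsHermitian) : (extOp A J)ᴴ * A * J = effOp A J := by
  have e1 : ((extOp A J)ᴴ * A * J)ᴴ = effOp A J := by
    rw [Matrix.conjTranspose_mul, Matrix.conjTranspose_mul, Matrix.conjTranspose_conjTranspose, hA.eq, ← Matrix.mul_assoc,
      conjTranspose_mul_mul_extOp h]
  rw [← Matrix.conjTranspose_conjTranspose ((extOp A J)ᴴ * A * J), e1, (effOp_isHermitian hA).eq]

/-- **UPPER COMPARISON**: `JᴴAJ − Ã = (E − J)ᴴ A (E − J)`, hence `Ã ≤ JᴴAJ` for `A ≥ 0`. [folklore] -/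
theorem sandwich_sub_effOp_eq (h : Admissible A J) (hA : A.IsHermitian) :
    Jᴴ * A * J - effOp A J = (extOp A J - J)ᴴ * A * (extOp A J - J) := by
  rw [Matrix.conjTranspose_sub, Matrix.sub_mul, Matrix.sub_mul, Matrix.mul_sub, Matrix.mul_sub,
    conjTranspose_extOp_mul_mul_extOp h, conjTranspose_extOp_mul_mul h hA, conjTranspose_mul_mul_extOp h]
  abel

/-- `Ã ≤ JᴴAJ` for `A ≥ 0`. [folklore] -/
theorem effOp_le_sandwich (h : Admissible A J) (hA : A.PosSemidef) : (Jᴴ * A * J - effOp A J).PosSemidef := by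
  rw [sandwich_sub_effOp_eq h hA.isHermitian]
  exact hA.conjTranspose_mul_mul_same _

end Summit.QuantumFields.BalabanUV.T4Continuum.OneStepEffectiveOperator

end
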